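import Literature.Computability.Cryptography.RegevSamplerRegs
import HarnessLib

/-!
# Regev 2009, Lemma 3.14 in machine form: the query data of a box point

Topic `Computability/Cryptography` (family `pqc`), grouping namespace `Regev2009.SamplerRegs`; sequel of
`RegevSamplerRegs.lean` (the prepared labels `lab₀`, the block contents `blocksOf` of a box point, the
register hypotheses `regHyps`) and of `RegevSamplerQuery.lean` / `RegevSamplerIndex.lean` (the query read
off the final label of the ideal classical run; good ⇒ admissible). Regev's Lemma 3.14 (J. ACM 56 (2009),
art. 34; author's version arXiv:2401.03703, p. 20, run as in the proof of Lemma 3.3, p. 15) hands the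
`CVP` procedure the point `x mod P(L*)`; in the tree's string model the substitution bound
`RegevSamplerSubstLaw.law_bound_sampler` asks, for every box point `x`, for `CVP` data `c(x)` with

* the query read off the label at the oracle call equal to the query STRING `CVPOracle.query I r k y c(x)`,
* `c(x)` in range, its answer table of the answer zone's length `n·b_c`,
* `c(x)` admissible at distance `d = √n/t` whenever the point is good (`‖x − y(x)‖ < √n`),

and for the size data `Y` (`‖y(x)‖ ≤ Y`) and `B` (`‖x − y(x')‖ ≤ B`) of the box. This file supplies them:

* `cOf` — the data `(sNat I R x̃, ℓ_R, b_c)` of the grid vector `x̃` of a box point (`R = 2^{ℓ_R}`),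
  `cOf_boxPt`;
* **`ofFn_qry_kappa_lab₀`** — the query read off the final label of the ideal run started on `lab₀(x)` IS
  `CVPOracle.query I r k y (cOf x)` (from `SamplerQuery.ofFn_qry_kappa` and
  `SamplerQuery.prefix_append_wordS_eq_query`);
* `inRange_cOf`, `length_answerTable_cOf`, **`admissible_cOf`** (good ⇒ admissible at `√n/t`, for
  `b_c ≤ ℓ_R`);
* `norm_yOfB_le_T` (`Y = t R⁻¹ Σ‖b∨ᵢ‖`), `norm_sub_yOfB_le_T` (`B = √n 2^ℓ/D_t + Y`), `lab₀_dirt`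
  (the prepared label is clean on any wires placed in the work window).

Everything is proved; the one definition has a body; no named fact is introduced.

## References

* O. Regev, *On lattices, learning with errors, random linear codes, and cryptography*, J. ACM 56
  (2009), art. 34; author's version arXiv:2401.03703: Lemma 3.14 (proof, p. 20), Lemma 3.3 (proof,
  p. 15), Lemma 3.5 [Regev2009].
* S. Arora, B. Barak, *Computational Complexity: A Modern Approach*, CUP 2009, §0.1 (pairing of
  strings) [AroraBarak2009].
-/

noncomputable section

namespace Literature.Computability.Cryptography

namespace Regev2009

namespace SamplerRegs

open Literature.Algebra.EuclideanLattices Literature.Algebra.EuclideanLattices.Regev2009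
  Literature.Algebra.EuclideanLattices.Regev2009.QPart Literature.Computability.QuantumComplexity
  Literature.Computability.Complexity Literature.LinearAlgebra.Matrix.Berkowitz Peikert2009 Finset SamplerArith
  SamplerScale SamplerGeom SamplerWords SamplerWordFns SamplerFormats SamplerQuery CVPOracle SamplerClassical
  SamplerClassical.Layout _root_.Computability Module
open scoped Real

variable {W : ℕ} (I : LatticeInstance) (Λ : Layout W I.n)

/-! ### The query data of a box point -/

/-- **The `CVP` data of a box point**: `(sNat I R x̃, ℓ_R, b_c)` for its grid vector `x̃` (`R = 2^{ℓ_R}`;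
junk off the box). [cite: Regev2009, Lemma 3.14 (proof: the point `x mod P(L)` handed to the oracle)] -/
def cOf (t : ℝ) (x : EuclideanSpace ℝ (Fin I.n)) : QData I.n :=
  (sNat I (2 ^ Λ.ℓR) (gridVec I (blocksOf I Λ.ℓ (DT I (2 ^ Λ.ℓR) t) x)), Λ.ℓR, Λ.bc)

/-- On a box point: the data of its grid vector. [folklore] -/
theorem cOf_boxPt [IsZLattice ℝ I.lattice] {t : ℝ} (ht : 0 < t) (Yb : Fin I.n → Fin Λ.ℓ → Bool) :
    cOf I Λ t (boxPt (DT I (2 ^ Λ.ℓR) t) Yb) = (sNat I (2 ^ Λ.ℓR) (gridVec I Yb), Λ.ℓR, Λ.bc) := by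
  rw [cOf, blocksOf_boxPt I (DT_pos I (2 ^ Λ.ℓR) ht).ne']

/-- The data are in range. [cite: Regev2009, Lemma 3.14 (proof)] -/
theorem inRange_cOf (t : ℝ) (x : EuclideanSpace ℝ (Fin I.n)) : InRange (cOf I Λ t x) :=
  inRange_sNat I (Nat.two_pow_pos _) le_rfl Λ.bc _

/-- The answer table has the answer zone's length. [folklore] -/
theorem length_answerTable_cOf (t : ℝ) (x : EuclideanSpace ℝ (Fin I.n)) :
    (answerTable I (cOf I Λ t x)).length = I.n * Λ.bc :=
  length_answerTable_sNat I _ _ _ _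

/-- The answer zone is long enough for the answer table (the form `law_bound_sampler` asks for). [folklore] -/
theorem le_length_answerTable_cOf (t : ℝ) (x : EuclideanSpace ℝ (Fin I.n)) :
    I.n * Λ.bc ≤ (answerTable I (cOf I Λ t x)).length :=
  (length_answerTable_cOf I Λ t x).ge

/-- **Good ⇒ admissible**: a box point with short lattice part (`‖x − y(x)‖ < √n`) has data admissible
at distance `√n/t`, for `b_c ≤ ℓ_R`. [cite: Regev2009, Lemma 3.14 (proof), Lemma 3.5] -/
theorem admissible_cOf [IsZLattice ℝ I.lattice] {t : ℝ} (ht : 0 < t) (hbc : Λ.bc ≤ Λ.ℓR)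
    {x : EuclideanSpace ℝ (Fin I.n)} (hx : x ∈ boxSet I.n Λ.ℓ (DT I (2 ^ Λ.ℓR) t))
    (hg : ‖x - yOfB (bRT I (2 ^ Λ.ℓR) t ht.ne') x‖ < Real.sqrt (finrank ℝ (EuclideanSpace ℝ (Fin I.n)))) :
    Admissible I (Real.sqrt I.n / t) (cOf I Λ t x) := by
  obtain ⟨Yb, -, rfl⟩ := mem_image.1 hx
  rw [cOf_boxPt I Λ ht]
  refine admissible_of_goodT I ht hbc (gridVec I Yb) ?_
  have hx' : boxPt (DT I (2 ^ Λ.ℓR) t) Yb = t • gridPt I (2 ^ Λ.ℓR) (gridVec I Yb) := boxPt_eq_smul_gridPt I (2 ^ Λ.ℓR) t Yb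
  rw [hx'] at hg
  exact hg

/-! ### The size data of the box -/

/-- **`‖y(x)‖ ≤ t R⁻¹ Σᵢ ‖b∨ᵢ‖`.** [cite: Regev2009, Lemma 3.12 (proof)] -/
theorem norm_yOfB_le_T [IsZLattice ℝ I.lattice] (R : ℕ) [NeZero R] {t : ℝ} (ht : 0 < t) (x : EuclideanSpace ℝ (Fin I.n)) :
    ‖yOfB (bRT I R t ht.ne') x‖ ≤ t * (R : ℝ)⁻¹ * ∑ i, ‖Peikert2009.dualVec I i‖ :=
  (norm_yOfB_le (bRT I R t ht.ne') x).trans (by rw [sum_norm_bRT, abs_of_pos ht])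

/-- **`‖x − y(x')‖ ≤ √n 2^ℓ/D_t + t R⁻¹ Σᵢ ‖b∨ᵢ‖`** for box points `x`. [folklore] -/
theorem norm_sub_yOfB_le_T [IsZLattice ℝ I.lattice] (R : ℕ) [NeZero R] {t : ℝ} (ht : 0 < t) {ℓ : ℕ} {x : EuclideanSpace ℝ (Fin I.n)}
    (hx : x ∈ boxSet I.n ℓ (DT I R t)) (x' : EuclideanSpace ℝ (Fin I.n)) :
    ‖x - yOfB (bRT I R t ht.ne') x'‖ ≤ Real.sqrt I.n * (2 ^ ℓ / DT I R t) + t * (R : ℝ)⁻¹ * ∑ i, ‖Peikert2009.dualVec I i‖ :=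
  norm_sub_yOfB_le (DT_pos I R ht) (by rw [sum_norm_bRT, abs_of_pos ht]) hx

/-! ### The query read off the final label -/

variable {Λ} (hΛ : Λ.OK)

include hΛ in
/-- **The query of the ideal run is the `CVP` query string of the point's data.** On the prepared label
`lab₀(x)` of a box point (input zone = the prefix `F_q` with THE doubled classical prefix of
`(I, r, k, y, ℓ_R, b_c)`, then the parameters), the query read off the final label of the ideal classical
run `kappa Λ (answerFn …)` is `CVPOracle.query I r k y (cOf x)`.
[cite: Regev2009, Lemma 3.14 (proof), Lemma 3.3 (proof)] [cite: AroraBarak2009, §0.1] -/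
theorem ofFn_qry_kappa_lab₀ [IsZLattice ℝ I.lattice] (hF : Fits Λ) {t : ℝ} (ht : 0 < t)
    (r : ℚ) (k : ℕ) (y : List Bool) (e : ℚ) (Fq pad : List Bool)
    (hFq0 : Fq = boolPair (boolPair (stageInput (GapSVPInstance.encode (I, r)) (k + 1) y) (boolPair (encodeNat Λ.ℓR) (encodeNat Λ.bc))) [])
    (hFq : Fq.length = Λ.Lq) (huz : (zoneOf Fq ((parOf I, 2 ^ Λ.ℓR), e) pad).length = Λ.L)
    (f : (Fin Λ.kq → Bool) → (Fin (I.n * Λ.bc) → Bool)) (Yb : Fin I.n → Fin Λ.ℓ → Bool) :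
    List.ofFn (qry Λ (kappa Λ f (lab₀ I Λ (2 ^ Λ.ℓR) t (zoneOf Fq ((parOf I, 2 ^ Λ.ℓR), e) pad) (boxPt (DT I (2 ^ Λ.ℓR) t) Yb)))) =
      query I r k y (cOf I Λ t (boxPt (DT I (2 ^ Λ.ℓR) t) Yb)) := by
  have hR0 : 0 < 2 ^ Λ.ℓR := Nat.two_pow_pos _
  have hR1 : 1 ≤ 2 ^ Λ.ℓR := hR0
  have hD : DT I (2 ^ Λ.ℓR) t ≠ 0 := (DT_pos I (2 ^ Λ.ℓR) ht).ne'
  have hYlen : (wordY ((parOf I, 2 ^ Λ.ℓR), e).1.1 I.n Λ.ℓ Λ.ℓY (pointsWord Yb)).length = I.n * Λ.ℓY := by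
    show (wordY (parOf I) I.n Λ.ℓ Λ.ℓY (pointsWord Yb)).length = _
    rw [wordY_points I Λ.ℓY Yb, length_tableZ]
  have hSlen : (wordS ((parOf I, 2 ^ Λ.ℓR), e).1.1 ((parOf I, 2 ^ Λ.ℓR), e).1.2 I.n Λ.ℓ Λ.ℓR (pointsWord Yb)).length = I.n * Λ.ℓR := by
    show (wordS (parOf I) (2 ^ Λ.ℓR) I.n Λ.ℓ Λ.ℓR (pointsWord Yb)).length = _
    rw [wordS_points I (2 ^ Λ.ℓR) hR1 Λ.ℓR Yb, CVPOracle.length_table]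
  have hzX : ∀ s, s < I.n * Λ.ℓ → lab₀ I Λ (2 ^ Λ.ℓR) t (zoneOf Fq ((parOf I, 2 ^ Λ.ℓR), e) pad) (boxPt (DT I (2 ^ Λ.ℓR) t) Yb) (Λ.fin s) =
      (pointsWord Yb).getD s false := fun s hs => by
    rw [lab₀_X I hΛ _ t _ _ hs, blocksOf_boxPt I hD]
  rw [ofFn_qry_kappa hΛ hF f ((parOf I, 2 ^ Λ.ℓR), e) (pointsWord Yb) Fq pad (length_pointsWord Yb) hFq huz hYlen hSlen _ hzX
    (fun s hs => lab₀_U I hΛ _ t _ _ hs) (fun s hs hs' => lab₀_R I hΛ _ t _ _ hs hs') (fun w hw => lab₀_window I hΛ _ t _ _ w hw),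
    hFq0, cOf_boxPt I Λ ht]
  exact prefix_append_wordS_eq_query I (2 ^ Λ.ℓR) hR1 Λ.ℓR Λ.bc Yb r k y

include hΛ in
/-- The same for every point of the box (the form `law_bound_sampler` asks for). [cite: Regev2009, Lemma 3.14 (proof)] -/
theorem ofFn_qry_kappa_lab₀_of_mem [IsZLattice ℝ I.lattice] (hF : Fits Λ) {t : ℝ} (ht : 0 < t)
    (r : ℚ) (k : ℕ) (y : List Bool) (e : ℚ) (Fq pad : List Bool)
    (hFq0 : Fq = boolPair (boolPair (stageInput (GapSVPInstance.encode (I, r)) (k + 1) y) (boolPair (encodeNat Λ.ℓR) (encodeNat Λ.bc))) [])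
    (hFq : Fq.length = Λ.Lq) (huz : (zoneOf Fq ((parOf I, 2 ^ Λ.ℓR), e) pad).length = Λ.L)
    (f : (Fin Λ.kq → Bool) → (Fin (I.n * Λ.bc) → Bool))
    (x : EuclideanSpace ℝ (Fin I.n)) (hx : x ∈ boxSet I.n Λ.ℓ (DT I (2 ^ Λ.ℓR) t)) :
    List.ofFn (qry Λ (kappa Λ f (lab₀ I Λ (2 ^ Λ.ℓR) t (zoneOf Fq ((parOf I, 2 ^ Λ.ℓR), e) pad) x))) = query I r k y (cOf I Λ t x) := by
  obtain ⟨Yb, -, rfl⟩ := mem_image.1 hx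
  exact ofFn_qry_kappa_lab₀ I hΛ hF ht r k y e Fq pad hFq0 hFq huz f Yb

include hΛ in
/-- **The prepared label is clean on wires placed in the work window** (e.g. the subroutine's own
register). [folklore] -/
theorem lab₀_dirt (R : ℕ) (t : ℝ) (uz : List Bool) {m : ℕ} (dirt : Fin m ↪ Fin W) (hdirt : ∀ s, Λ.base ≤ (dirt s : ℕ))
    (x : EuclideanSpace ℝ (Fin I.n)) (s : Fin m) : lab₀ I Λ R t uz x (dirt s) = false :=
  lab₀_window I hΛ R t uz x (dirt s) (hdirt s)

end SamplerRegs

end Regev2009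

end Literature.Computability.Cryptography

end
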